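import Summits.Ventures.CertifiedManyBodySolver.Observables.StiffnessThermalTrialGeneratorCeiling
import HarnessLib

/-!
# The thermal TRIAL-GENERATOR hook: a certified thermal bound on ONE local word `W_a` at ONE `β`, for ANY admissible
# local generator `a`, feeds the single-temperature Kosterlitz–Thouless stiffness leaf (part 2 of 2)

HONEST FRAMING: a one-sided CEILING chain (thermal Gibbs words ⇒ flux stiffness ⇒ `T_KT` under the thermal KT dictionary);
KT ceilings never assert superconductivity; NO lower bound on `T_c` is claimed; NO certificate and NO number lives in this
file; no summit, rung or crux statement is proved here. Cell `pub/hubbard-tc` × sub-crew `speedrun/mbsolver/hubbard-thermal`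
(D-0154 (1) block (D) «THERMAL CERTIFICATES»), seat `hubbard-thermal-p4` (typist: certificate objects + reader theorems).

Part 1 (`StiffnessThermalTrialGeneratorCeiling.lean`) proved, at every side `L ≥ 6r+5`, the mixture-level inequality
`ρ_s ≤ Re Σ_i p_{L,i}(β)·torusAvg(W_a)(ψ_{L,i})` for the word `W_a = ½Γk₀ + i·Γd_a + ½m_a ∈ 𝔄_{[-(3r+2),3r+2]²}` of an
admissible local generator `a ∈ 𝔄_{[-r,r]²}` (Hermitian, even, `[a,N] = [a,S^z] = 0`). Here:

* §3 **the hook** `ObsThermalStiffnessSeqCeilingAtBeta_of_torusLimit_trialGeneratorWord_le`: if every torus limit `ω` of the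
  canonical `(rectN n L, S^z = 0)` Gibbs states of `hubbardTorusTT' L 1 t′ U` at `β` has `Re ω(W_a) ≤ q` (ONE certified thermal
  LINEAR word), then `ObsThermalStiffnessSeqCeilingAtBeta t′ U n β q` (compactness + `limsup`,
  `eventually_re_sectorGibbsAvg_le_of_forall_torusLimit`). This is STUB 1 `TrialGeneratorHook` of the crux-plan line «trialgen_b10»
  of route «hubbard-tc-thermcert-1» (K1 anchor `β·t = 10` and K2-box skeletons), general in `(t′, U, n, β, r, a, q)`; the word is
  written with tree functions only, term for term the line's `trialWord t′ U r a`, so the stub closes by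
  `by intro tp U n β hβ hn0 hn2 r a ha q hb; exact …_trialGeneratorWord_le hβ hn0 hn2 r a ha.1 ha.2.1 ha.2.2.1 ha.2.2.2 hb`
  (checked against the line's §0 objects copied verbatim; route item K1 = stmt-Ventures-26381, K2 = stmt-Ventures-26382).
  The Krylov member is hubbard-tc-mod-2's `ObsThermalStiffnessSeqCeilingAtBeta_of_torusLimit_oddMoment_le`.
* §4 the `ThermalKTDictionaryAt` closure `(π/4)q < 1/β ⇒ T_c ≤ 1/β` from one trial-generator word.

WHAT THIS IS NOT: no thermal certificate of any word `W_a` exists today; the hook is one implication «certified word ⇒ leaf».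
Float context (hubbard-tc-mod-2, 12-site tori, not of record): the single Krylov member captures 48–78 % of the ideal (Kohn)
polarisation gain, the 3-word family 60–88 %; the class never sees the energy-diagonal (Drude-type) part of the current response.

References: DLS1978 §2 eqs. (22′), (27), (28); Lipparini2008 eq. (8.30); BratteliRobinsonII1997 Thm. 6.2.4;
ScalapinoWhiteZhang1993 §II; HazraVermaRanderia2019 eqs. (2)–(4); Israel1979 §I.3 eq. (26).
-/

noncomputable section

namespace Summit.Ventures.CertifiedManyBodySolver.Observables

open Filter Topology Matrix Finset
open Literature.MathematicalPhysics.QuantumLattice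
open Literature.MathematicalPhysics.QuantumLattice.ThermodynamicLimit
open Literature.MathematicalPhysics.QuantumFieldTheory
open Literature.MathematicalPhysics.StatisticalMechanics
open Literature.MathematicalPhysics.StatisticalMechanics.KosterlitzThouless
open Literature.Probability.LatticeModels
open scoped ComplexConjugate ComplexOrder

/-! ## §3 The hook: a torus-limit bound on the word `W_a` feeds the single-temperature leaf -/

section Hook

/-- **The single-temperature stiffness leaf from a torus-limit TRIAL-GENERATOR bound (all-generators hook).** Let
`a ∈ 𝔄_{[-r,r]²}` be Hermitian, even, and commute with `N` and `S^z`. If every torus limit `ω` of the canonical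
`(rectN n L, S^z = 0)` Gibbs states of `hubbardTorusTT' L 1 t′ U` at inverse temperature `β` (`IsTorusLimitOfMixture` of
`sectorGibbsWeightTT' β 1 t′ U n`, `sectorGibbsVectorTT' 1 t′ U n`; `0 ≤ n ≤ 2`) satisfies `Re ω(W_a) ≤ q` for the ONE local word
`W_a = ½Γk₀ + i·Γd_a + ½m_a ∈ 𝔄_{[-(3r+2),3r+2]²}`, then `ObsThermalStiffnessSeqCeilingAtBeta t′ U n β q`. Chain: compactness +
`limsup` (`eventually_re_sectorGibbsAvg_le_of_forall_torusLimit`): for every `ε > 0`, eventually in `L` the Gibbs-mixture torus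
average of `W_a` is `≤ q + ε` ⇒ §2 at a large side of the given sequence ⇒ `ρ_s ≤ q + ε` ⇒ `ρ_s ≤ q`. The Krylov member
(`a` built from `j₀`) is `ObsThermalStiffnessSeqCeilingAtBeta_of_torusLimit_oddMoment_le`; this is STUB 1 `TrialGeneratorHook`
of the crux-plan line «trialgen_b10» (route «hubbard-tc-thermcert-1», K1 and K2-box skeletons), word-for-word its `trialWord t′ U r a`.
[cite: DLS1978, §2 eqs. (22'), (27), (28)] [cite: Lipparini2008, eq. (8.30)] [cite: BratteliRobinsonII1997, Thm. 6.2.4] -/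
theorem ObsThermalStiffnessSeqCeilingAtBeta_of_torusLimit_trialGeneratorWord_le {tp U n β : ℝ} (hβ : 0 < β)
    (hn0 : 0 ≤ n) (hn2 : n ≤ 2) (r : ℕ) (a : FermionOp (box 2 r)) (ha : a.IsHermitian)
    (hae : a ∈ carEvenSubalgebra (Finset.univ : Finset (Orb (PolySite (box 2 r)))))
    (haN : Commute a totalNumber) (haS : Commute a HubbardWave0.spinZ) {q : ℚ}
    (hbound : ∀ (ω : InfVolFermionState 2) (Ls : ℕ → ℕ), Tendsto Ls atTop atTop →
      ω.IsTorusLimitOfMixture (sectorGibbsCount n) (fun L => sectorGibbsWeightTT' β 1 tp U n L)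
        (fun L => sectorGibbsVectorTT' 1 tp U n L) Ls →
      (ω.expect (box 2 (3 * r + 2))
        (((1 / 2 : ℝ) : ℂ) • fermionEmbed (PolySite.incl (box_subset_box (by omega) : box 2 1 ⊆ box 2 (3 * r + 2)))
            (kinBondObsTT tp) +
          Complex.I • fermionEmbed (PolySite.incl (box_subset_box (by omega) : box 2 (r + 2) ⊆ box 2 (3 * r + 2)))
            (commDensity (box 2 (r + 2)) (box 2 (r + 1)) (box_subset_box (by omega)) (curBondObsTT tp) a) +
          ((1 / 2 : ℝ) : ℂ) • commDensity (box 2 (3 * r + 2)) (box 2 (2 * r + 1)) (box_subset_box (by omega)) a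
            ((hubbardTTPrimeFermionInteraction 1 tp U).localHamiltonian (box 2 (r + 1)) *
                fermionEmbed (PolySite.incl (box_subset_box (by omega) : box 2 r ⊆ box 2 (r + 1))) a -
              fermionEmbed (PolySite.incl (box_subset_box (by omega) : box 2 r ⊆ box 2 (r + 1))) a *
                (hubbardTTPrimeFermionInteraction 1 tp U).localHamiltonian (box 2 (r + 1))))).re ≤ ((q : ℚ) : ℝ)) :
    ObsThermalStiffnessSeqCeilingAtBeta tp U n β q := by
  intro ρs θ₀ hρs hθ₀ Ls hLs hst
  refine le_of_forall_pos_le_add fun ε hε => ?_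
  have hev := eventually_re_sectorGibbsAvg_le_of_forall_torusLimit 1 tp U hn0 hn2 β (box 2 (3 * r + 2)) _ hbound hε
  -- along the sequence: eventually `Ls j ≥ 6r+5` and the mixture bound holds at `Ls j`
  obtain ⟨j, hjL, hjb⟩ := ((hLs.eventually_ge_atTop (6 * r + 5)).and (hLs.eventually hev)).exists
  haveI : NeZero (Ls j) := ⟨by omega⟩
  have hfin := thermalStiffness_le_re_sectorGibbsAvg_trialGeneratorWord (L := Ls j) (tp := tp) (U := U) (n := n) hβ hjL ha hae
    (preservesSectors_of_commute_totalNumber_spinZ haN haS) hθ₀ (hst j)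
  simp_rw [torusAvgExpect_eq] at hjb
  exact hfin.trans hjb

end Hook

/-! ## §4 `T_c` closure under the thermal KT dictionary -/

namespace ThermalKTDictionaryAt

variable {tp U n : ℝ} {ρe : ℝ → ℝ} {Tc : ℝ}

/-- **One certified thermal trial-generator word at `β` + `(π/4)q < 1/β` ⇒ `T_c ≤ 1/β`** (monotonicity-free
`ThermalKTDictionaryAt`: Nelson–Kosterlitz stability + thermal identification as hypotheses; any admissible generator `a`).
[cite: HazraVermaRanderia2019, eqs. (2)–(4)] [cite: DLS1978, §2 eq. (28)] -/
theorem le_inv_of_torusLimit_trialGeneratorWord_le (h : ThermalKTDictionaryAt tp U n ρe Tc) {β : ℝ} (hβ : 0 < β)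
    (hn0 : 0 ≤ n) (hn2 : n ≤ 2) (r : ℕ) (a : FermionOp (box 2 r)) (ha : a.IsHermitian)
    (hae : a ∈ carEvenSubalgebra (Finset.univ : Finset (Orb (PolySite (box 2 r)))))
    (haN : Commute a totalNumber) (haS : Commute a HubbardWave0.spinZ) {q : ℚ}
    (hbound : ∀ (ω : InfVolFermionState 2) (Ls : ℕ → ℕ), Tendsto Ls atTop atTop →
      ω.IsTorusLimitOfMixture (sectorGibbsCount n) (fun L => sectorGibbsWeightTT' β 1 tp U n L)
        (fun L => sectorGibbsVectorTT' 1 tp U n L) Ls →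
      (ω.expect (box 2 (3 * r + 2))
        (((1 / 2 : ℝ) : ℂ) • fermionEmbed (PolySite.incl (box_subset_box (by omega) : box 2 1 ⊆ box 2 (3 * r + 2)))
            (kinBondObsTT tp) +
          Complex.I • fermionEmbed (PolySite.incl (box_subset_box (by omega) : box 2 (r + 2) ⊆ box 2 (3 * r + 2)))
            (commDensity (box 2 (r + 2)) (box 2 (r + 1)) (box_subset_box (by omega)) (curBondObsTT tp) a) +
          ((1 / 2 : ℝ) : ℂ) • commDensity (box 2 (3 * r + 2)) (box 2 (2 * r + 1)) (box_subset_box (by omega)) a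
            ((hubbardTTPrimeFermionInteraction 1 tp U).localHamiltonian (box 2 (r + 1)) *
                fermionEmbed (PolySite.incl (box_subset_box (by omega) : box 2 r ⊆ box 2 (r + 1))) a -
              fermionEmbed (PolySite.incl (box_subset_box (by omega) : box 2 r ⊆ box 2 (r + 1))) a *
                (hubbardTTPrimeFermionInteraction 1 tp U).localHamiltonian (box 2 (r + 1))))).re ≤ ((q : ℚ) : ℝ))
    (hlt : Real.pi / 4 * ((q : ℚ) : ℝ) < 1 / β) : Tc ≤ 1 / β :=
  h.le_inv_of_leafAtBeta hβ
    (ObsThermalStiffnessSeqCeilingAtBeta_of_torusLimit_trialGeneratorWord_le hβ hn0 hn2 r a ha hae haN haS hbound) hlt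

end ThermalKTDictionaryAt

end Summit.Ventures.CertifiedManyBodySolver.Observables
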